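import Summits.KontsevichZagierPeriods.Zeta5Search.Certificates.ModRedLK3Kernel
import Summits.KontsevichZagierPeriods.Zeta5Search.SymmetricFamilyInnerSum
import HarnessLib

/-!
# ζ(5) search — brown9 LEVEL 2 (L-K3): the termwise creative-telescoping identity (cell `pub-zeta5`, certifier `cert-2`)

HONEST FRAMING: systematic search; no irrationality claim unless certified.

From the kernel-checked coordinate sum `LK3_csum_zero` (module reduction, `ModRedLK3Kernel`) we re-attach units and
denominators and obtain the ttrl2 lane's TERMWISE identity for the pure `k₃`-shift relation (L-K3) of the triple sum
`L(n,k₃) = Σ_{k₂} sL(n,k₃,k₂)`, `sL = (−1)^{k₂} C(n,k₂)·T(n;p,q₁)·T(n;p,q₂)` (`p = 3n−k₂−k₃`, `q₁ = 3n−k₃`, `q₂ = 2n−k₂`):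
`Σ_{j=0}^{3} η_j(n,x)·sL(n,x+j,k) = gL(n,x,k+1) − gL(n,x,k)` for `n ≥ 2`, `x ∉ ℤ`, `k + 2 ≤ n` (`LK3_termwise`), where
`gL = (−1)^k C(n,k)·SL/dden`, `SL = Σ_ab Ψ_ab·T(n;p+a,q₁)T(n;p+b,q₂)`, `dden = (k+1)(n−k)(x+k−2n)²(x+k−2n+1)²(x+k−2n+2)²`.
Ingredients: the values of the 11 pair symbols (`TvL_val`), the three clearing products (`fprod` over `ftL`), the shift
consistency of the data (`PsiL··S_eq`, kernel `decide`), and `C(n,k+1)(k+1) = C(n,k)(n−k)` (`SymmetricRecursion.choose_succ_right_cast`).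
-/

noncomputable section

namespace Summit.KontsevichZagierPeriods.Zeta5Search.Certificates

namespace VIMInner.ModRed

open Summit.KontsevichZagierPeriods.Zeta5Search.PolyReflect

/-- The summand of the triple sum `L(n,x) = Σ_k sL(n,x,k)`: `(−1)^k C(n,k)·T(n;3n−x−k,3n−x)·T(n;3n−x−k,2n−k)`
(`x = k₃`, `k = k₂`). -/
def sL (n : ℕ) (x : ℚ) (k : ℕ) : ℚ :=
  (-1) ^ k * (n.choose k : ℚ) * (T n (3 * (n : ℚ) - x - k) (3 * (n : ℚ) - x) * T n (3 * (n : ℚ) - x - k) (2 * (n : ℚ) - k))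

/-- The certificate denominator `dden = (k+1)(n−k)(x+k−2n)²(x+k−2n+1)²(x+k−2n+2)²`. -/
def ddenL (n : ℕ) (x : ℚ) (k : ℕ) : ℚ :=
  ((k : ℚ) + 1) * ((n : ℚ) - k) * ((x + k - 2 * n) ^ 2 * (x + k - 2 * n + 1) ^ 2 * (x + k - 2 * n + 2) ^ 2)

/-- The module part of the certificate: `SL = Σ_ab Ψ_ab(n,x,k)·T(n;p+a,q₁)·T(n;p+b,q₂)`. -/
def SL (n : ℕ) (x : ℚ) (k : ℕ) : ℚ :=
  ev3 PsiL00 n x k * (T n (3 * (n : ℚ) - x - k) (3 * (n : ℚ) - x) * T n (3 * (n : ℚ) - x - k) (2 * (n : ℚ) - k))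
  + ev3 PsiL01 n x k * (T n (3 * (n : ℚ) - x - k) (3 * (n : ℚ) - x) * T n (3 * (n : ℚ) - x - k + 1) (2 * (n : ℚ) - k))
  + ev3 PsiL10 n x k * (T n (3 * (n : ℚ) - x - k + 1) (3 * (n : ℚ) - x) * T n (3 * (n : ℚ) - x - k) (2 * (n : ℚ) - k))
  + ev3 PsiL11 n x k *
    (T n (3 * (n : ℚ) - x - k + 1) (3 * (n : ℚ) - x) * T n (3 * (n : ℚ) - x - k + 1) (2 * (n : ℚ) - k))

/-- The certificate `gL(n,x,k) = (−1)^k C(n,k) · SL(n,x,k) / dden(n,x,k)`. -/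
def gL (n : ℕ) (x : ℚ) (k : ℕ) : ℚ := (-1) ^ k * (n.choose k : ℚ) * SL n x k / ddenL n x k

/-- Shift consistency of the data: `PsiL00S(n,x,k) = Ψ₀₀(n,x,k+1)` (kernel identity check). -/
theorem PsiL00S_eq (w x k : ℚ) : ev3 PsiL00S w x k = ev3 PsiL00 w x (k + 1) := by
  rw [← ev3_shift3]; exact ev3_eq_of_isZero3_sub3 _ _ (by decide +kernel) w x k

/-- Shift consistency of the data: `PsiL01S(n,x,k) = Ψ₀₁(n,x,k+1)`. -/
theorem PsiL01S_eq (w x k : ℚ) : ev3 PsiL01S w x k = ev3 PsiL01 w x (k + 1) := by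
  rw [← ev3_shift3]; exact ev3_eq_of_isZero3_sub3 _ _ (by decide +kernel) w x k

/-- Shift consistency of the data: `PsiL10S(n,x,k) = Ψ₁₀(n,x,k+1)`. -/
theorem PsiL10S_eq (w x k : ℚ) : ev3 PsiL10S w x k = ev3 PsiL10 w x (k + 1) := by
  rw [← ev3_shift3]; exact ev3_eq_of_isZero3_sub3 _ _ (by decide +kernel) w x k

/-- Shift consistency of the data: `PsiL11S(n,x,k) = Ψ₁₁(n,x,k+1)`. -/
theorem PsiL11S_eq (w x k : ℚ) : ev3 PsiL11S w x k = ev3 PsiL11 w x (k + 1) := by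
  rw [← ev3_shift3]; exact ev3_eq_of_isZero3_sub3 _ _ (by decide +kernel) w x k

/-- Value of a tabulated pair symbol with prescribed (ring-equal) argument forms. -/
theorem TvL_val {tab : List (ℕ × ℤ × ℤ × ℕ × ℤ × ℤ)} {n : ℕ} {x : ℚ} {k s : ℕ} {j₁ l₁ j₂ l₂ : ℤ}
    (h : tab[s]? = some (0, j₁, l₁, 0, j₂, l₂)) (a b c d : ℚ) (ha : a = 3 * (n : ℚ) - x - k + j₁)
    (hb : b = 3 * (n : ℚ) - x + l₁) (hc : c = 3 * (n : ℚ) - x - k + j₂) (hd : d = 2 * (n : ℚ) - k + l₂) :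
    TvL tab n x k s = T n a b * T n c d := by
  subst ha hb hc hd; simpa using TvL_of_eq h

/-- The clearing product of the `η`-terms: `MF = (k+1)(k+2)(n−k)(n−k−1)(x+k−2n)²(x+k−2n+1)²(x+k−2n+2)²(x+k−2n+3)²`. -/
theorem fprod_MF (n : ℕ) (x : ℚ) (k : ℕ) : fprod ftL [15, 16, 12, 17, 18, 18, 19, 19, 20, 20, 21, 21] n x k =
    ((k : ℚ) + 1) * ((k : ℚ) + 2) * ((n : ℚ) - k) * ((n : ℚ) - k - 1) *
      ((x + k - 2 * n) ^ 2 * (x + k - 2 * n + 1) ^ 2 * (x + k - 2 * n + 2) ^ 2 * (x + k - 2 * n + 3) ^ 2) := by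
  simp [fprod, ftL, linVal]; ring

/-- The clearing product of the `Ψ(k)`-terms: `PF = (k+2)(n−k−1)(x+k−2n+3)²`. -/
theorem fprod_PF (n : ℕ) (x : ℚ) (k : ℕ) : fprod ftL [16, 17, 21, 21] n x k =
    ((k : ℚ) + 2) * ((n : ℚ) - k - 1) * (x + k - 2 * n + 3) ^ 2 := by
  simp [fprod, ftL, linVal]; ring

/-- The clearing product of the `Ψ(k+1)`-terms: `SF = (n−k)²(x+k−2n)²`. -/
theorem fprod_SF (n : ℕ) (x : ℚ) (k : ℕ) : fprod ftL [12, 12, 18, 18] n x k =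
    ((n : ℚ) - k) ^ 2 * (x + k - 2 * n) ^ 2 := by
  simp [fprod, ftL, linVal]; ring

set_option maxHeartbeats 8000000 in
/-- **(L-K3) termwise** (cert-2, kernel module reduction in coordinate form): for `n ≥ 2`, `x ∉ ℤ`, `k + 2 ≤ n`,
`η₀ sL(n,x,k) + η₁ sL(n,x+1,k) + η₂ sL(n,x+2,k) + η₃ sL(n,x+3,k) = gL(n,x,k+1) − gL(n,x,k)`. -/
theorem LK3_termwise (n : ℕ) (hn : 2 ≤ n) (x : ℚ) (hx : ∀ z : ℤ, x ≠ z) (k : ℕ) (hk : k + 2 ≤ n) :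
    ev2 etaL0 n x * sL n x k + ev2 etaL1 n x * sL n (x + 1) k + ev2 etaL2 n x * sL n (x + 2) k
      + ev2 etaL3 n x * sL n (x + 3) k = gL n x (k + 1) - gL n x k := by
  have hcs := LK3_csum_zero n hn x hx k (by omega)
  simp only [ctermSum, termsL, fprod_MF, fprod_PF, fprod_SF, ev3_cons, ev3_nil, mul_zero, add_zero] at hcs
  -- the eleven pair symbols
  have hX0 : TvL tabL n x k 0 = T n (3 * (n : ℚ) - x - k) (3 * (n : ℚ) - x) *
      T n (3 * (n : ℚ) - x - k) (2 * (n : ℚ) - k) :=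
    TvL_val (show tabL[0]? = some (0, 0, 0, 0, 0, 0) by rfl) _ _ _ _ (by push_cast; ring) (by push_cast; ring) (by push_cast; ring) (by push_cast; ring)
  have hX1 : TvL tabL n x k 1 = T n (3 * (n : ℚ) - (x + 1) - k) (3 * (n : ℚ) - (x + 1)) *
      T n (3 * (n : ℚ) - (x + 1) - k) (2 * (n : ℚ) - k) :=
    TvL_val (show tabL[1]? = some (0, -1, -1, 0, -1, 0) by rfl) _ _ _ _ (by push_cast; ring) (by push_cast; ring) (by push_cast; ring) (by push_cast; ring)
  have hX2 : TvL tabL n x k 2 = T n (3 * (n : ℚ) - (x + 2) - k) (3 * (n : ℚ) - (x + 2)) *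
      T n (3 * (n : ℚ) - (x + 2) - k) (2 * (n : ℚ) - k) :=
    TvL_val (show tabL[2]? = some (0, -2, -2, 0, -2, 0) by rfl) _ _ _ _ (by push_cast; ring) (by push_cast; ring) (by push_cast; ring) (by push_cast; ring)
  have hX3 : TvL tabL n x k 3 = T n (3 * (n : ℚ) - (x + 3) - k) (3 * (n : ℚ) - (x + 3)) *
      T n (3 * (n : ℚ) - (x + 3) - k) (2 * (n : ℚ) - k) :=
    TvL_val (show tabL[3]? = some (0, -3, -3, 0, -3, 0) by rfl) _ _ _ _ (by push_cast; ring) (by push_cast; ring) (by push_cast; ring) (by push_cast; ring)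
  -- the shifted basis e⁺_ab = T(n;p−1+a,q₁)·T(n;p−1+b,q₂−1), written with `k+1`
  have hX4 : TvL tabL n x k 4 = T n (3 * (n : ℚ) - x - ((k : ℚ) + 1)) (3 * (n : ℚ) - x) *
      T n (3 * (n : ℚ) - x - ((k : ℚ) + 1)) (2 * (n : ℚ) - ((k : ℚ) + 1)) :=
    TvL_val (show tabL[4]? = some (0, -1, 0, 0, -1, -1) by rfl) _ _ _ _ (by push_cast; ring) (by push_cast; ring) (by push_cast; ring) (by push_cast; ring)
  have hX5 : TvL tabL n x k 5 = T n (3 * (n : ℚ) - x - k) (3 * (n : ℚ) - x) *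
      T n (3 * (n : ℚ) - x - k + 1) (2 * (n : ℚ) - k) :=
    TvL_val (show tabL[5]? = some (0, 0, 0, 0, 1, 0) by rfl) _ _ _ _ (by push_cast; ring) (by push_cast; ring) (by push_cast; ring) (by push_cast; ring)
  have hX6 : TvL tabL n x k 6 = T n (3 * (n : ℚ) - x - ((k : ℚ) + 1)) (3 * (n : ℚ) - x) *
      T n (3 * (n : ℚ) - x - ((k : ℚ) + 1) + 1) (2 * (n : ℚ) - ((k : ℚ) + 1)) :=
    TvL_val (show tabL[6]? = some (0, -1, 0, 0, 0, -1) by rfl) _ _ _ _ (by push_cast; ring) (by push_cast; ring) (by push_cast; ring) (by push_cast; ring)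
  have hX7 : TvL tabL n x k 7 = T n (3 * (n : ℚ) - x - k + 1) (3 * (n : ℚ) - x) *
      T n (3 * (n : ℚ) - x - k) (2 * (n : ℚ) - k) :=
    TvL_val (show tabL[7]? = some (0, 1, 0, 0, 0, 0) by rfl) _ _ _ _ (by push_cast; ring) (by push_cast; ring) (by push_cast; ring) (by push_cast; ring)
  have hX8 : TvL tabL n x k 8 = T n (3 * (n : ℚ) - x - ((k : ℚ) + 1) + 1) (3 * (n : ℚ) - x) *
      T n (3 * (n : ℚ) - x - ((k : ℚ) + 1)) (2 * (n : ℚ) - ((k : ℚ) + 1)) :=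
    TvL_val (show tabL[8]? = some (0, 0, 0, 0, -1, -1) by rfl) _ _ _ _ (by push_cast; ring) (by push_cast; ring) (by push_cast; ring) (by push_cast; ring)
  have hX9 : TvL tabL n x k 9 = T n (3 * (n : ℚ) - x - k + 1) (3 * (n : ℚ) - x) *
      T n (3 * (n : ℚ) - x - k + 1) (2 * (n : ℚ) - k) :=
    TvL_val (show tabL[9]? = some (0, 1, 0, 0, 1, 0) by rfl) _ _ _ _ (by push_cast; ring) (by push_cast; ring) (by push_cast; ring) (by push_cast; ring)
  have hX10 : TvL tabL n x k 10 = T n (3 * (n : ℚ) - x - ((k : ℚ) + 1) + 1) (3 * (n : ℚ) - x) *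
      T n (3 * (n : ℚ) - x - ((k : ℚ) + 1) + 1) (2 * (n : ℚ) - ((k : ℚ) + 1)) :=
    TvL_val (show tabL[10]? = some (0, 0, 0, 0, 0, -1) by rfl) _ _ _ _ (by push_cast; ring) (by push_cast; ring) (by push_cast; ring) (by push_cast; ring)
  rw [hX0, hX1, hX2, hX3, hX4, hX5, hX6, hX7, hX8, hX9, hX10, PsiL00S_eq, PsiL01S_eq, PsiL10S_eq, PsiL11S_eq] at hcs
  -- units and denominators
  set U : ℚ := (-1) ^ k * (n.choose k : ℚ) with hUdef
  set U1 : ℚ := (-1) ^ (k + 1) * (n.choose (k + 1) : ℚ) with hU1def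
  have hU : ((k : ℚ) + 1) * U1 = -(((n : ℚ) - k) * U) := by
    rw [hUdef, hU1def, pow_succ]
    have := SymmetricRecursion.choose_succ_right_cast n k
    linear_combination (-((-1 : ℚ) ^ k)) * this
  have hd0 : ddenL n x k ≠ 0 := by
    have h1 : (k : ℚ) + 1 ≠ 0 := by positivity
    have h2 : (n : ℚ) - k ≠ 0 := by
      have : (k : ℚ) + 2 ≤ n := by exact_mod_cast hk
      intro h; linarith
    have h3 : x + k - 2 * n ≠ 0 := fun h => hx (2 * n - k) (by push_cast; linarith)
    have h4 : x + k - 2 * n + 1 ≠ 0 := fun h => hx (2 * n - k - 1) (by push_cast; linarith)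
    have h5 : x + k - 2 * n + 2 ≠ 0 := fun h => hx (2 * n - k - 2) (by push_cast; linarith)
    unfold ddenL
    exact mul_ne_zero (mul_ne_zero h1 h2) (mul_ne_zero (mul_ne_zero (pow_ne_zero _ h3) (pow_ne_zero _ h4))
      (pow_ne_zero _ h5))
  have hd1 : ddenL n x (k + 1) ≠ 0 := by
    have h1 : ((k + 1 : ℕ) : ℚ) + 1 ≠ 0 := by positivity
    have h2 : (n : ℚ) - ((k + 1 : ℕ) : ℚ) ≠ 0 := by
      have : (k : ℚ) + 2 ≤ n := by exact_mod_cast hk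
      push_cast; intro h; linarith
    have h3 : x + ((k + 1 : ℕ) : ℚ) - 2 * n ≠ 0 := fun h => hx (2 * n - k - 1) (by push_cast at h ⊢; linarith)
    have h4 : x + ((k + 1 : ℕ) : ℚ) - 2 * n + 1 ≠ 0 := fun h => hx (2 * n - k - 2) (by push_cast at h ⊢; linarith)
    have h5 : x + ((k + 1 : ℕ) : ℚ) - 2 * n + 2 ≠ 0 := fun h => hx (2 * n - k - 3) (by push_cast at h ⊢; linarith)
    unfold ddenL
    exact mul_ne_zero (mul_ne_zero h1 h2) (mul_ne_zero (mul_ne_zero (pow_ne_zero _ h3) (pow_ne_zero _ h4))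
      (pow_ne_zero _ h5))
  have hg0 : ddenL n x k * gL n x k = U * SL n x k := by
    rw [gL, hUdef]; field_simp
  have hg1 : ddenL n x (k + 1) * gL n x (k + 1) = U1 * SL n x (k + 1) := by
    rw [gL, hU1def]; field_simp
  -- the clearing product MF is non-zero: cancel it
  have hMF : ((k : ℚ) + 1) * ((k : ℚ) + 2) * ((n : ℚ) - k) * ((n : ℚ) - k - 1) *
      ((x + k - 2 * n) ^ 2 * (x + k - 2 * n + 1) ^ 2 * (x + k - 2 * n + 2) ^ 2 * (x + k - 2 * n + 3) ^ 2) ≠ 0 := by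
    have h1 : (k : ℚ) + 1 ≠ 0 := by positivity
    have h1' : (k : ℚ) + 2 ≠ 0 := by positivity
    have hk' : (k : ℚ) + 2 ≤ n := by exact_mod_cast hk
    have h2 : (n : ℚ) - k ≠ 0 := by intro h; linarith
    have h2' : (n : ℚ) - k - 1 ≠ 0 := by intro h; linarith
    have h3 : x + k - 2 * n ≠ 0 := fun h => hx (2 * n - k) (by push_cast; linarith)
    have h4 : x + k - 2 * n + 1 ≠ 0 := fun h => hx (2 * n - k - 1) (by push_cast; linarith)
    have h5 : x + k - 2 * n + 2 ≠ 0 := fun h => hx (2 * n - k - 2) (by push_cast; linarith)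
    have h6 : x + k - 2 * n + 3 ≠ 0 := fun h => hx (2 * n - k - 3) (by push_cast; linarith)
    exact mul_ne_zero (mul_ne_zero (mul_ne_zero (mul_ne_zero h1 h1') h2) h2')
      (mul_ne_zero (mul_ne_zero (mul_ne_zero (pow_ne_zero _ h3) (pow_ne_zero _ h4)) (pow_ne_zero _ h5))
        (pow_ne_zero _ h6))
  refine mul_left_cancel₀ hMF ?_
  have e0 : sL n x k = U * (T n (3 * (n : ℚ) - x - k) (3 * (n : ℚ) - x) *
      T n (3 * (n : ℚ) - x - k) (2 * (n : ℚ) - k)) := by rw [sL, hUdef]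
  have e1 : sL n (x + 1) k = U * (T n (3 * (n : ℚ) - (x + 1) - k) (3 * (n : ℚ) - (x + 1)) *
      T n (3 * (n : ℚ) - (x + 1) - k) (2 * (n : ℚ) - k)) := by rw [sL, hUdef]
  have e2 : sL n (x + 2) k = U * (T n (3 * (n : ℚ) - (x + 2) - k) (3 * (n : ℚ) - (x + 2)) *
      T n (3 * (n : ℚ) - (x + 2) - k) (2 * (n : ℚ) - k)) := by rw [sL, hUdef]
  have e3 : sL n (x + 3) k = U * (T n (3 * (n : ℚ) - (x + 3) - k) (3 * (n : ℚ) - (x + 3)) *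
      T n (3 * (n : ℚ) - (x + 3) - k) (2 * (n : ℚ) - k)) := by rw [sL, hUdef]
  have eS0 : SL n x k = ev3 PsiL00 n x k * (T n (3 * (n : ℚ) - x - k) (3 * (n : ℚ) - x) *
      T n (3 * (n : ℚ) - x - k) (2 * (n : ℚ) - k))
    + ev3 PsiL01 n x k * (T n (3 * (n : ℚ) - x - k) (3 * (n : ℚ) - x) * T n (3 * (n : ℚ) - x - k + 1) (2 * (n : ℚ) - k))
    + ev3 PsiL10 n x k * (T n (3 * (n : ℚ) - x - k + 1) (3 * (n : ℚ) - x) * T n (3 * (n : ℚ) - x - k) (2 * (n : ℚ) - k))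
    + ev3 PsiL11 n x k *
      (T n (3 * (n : ℚ) - x - k + 1) (3 * (n : ℚ) - x) * T n (3 * (n : ℚ) - x - k + 1) (2 * (n : ℚ) - k)) := rfl
  have eS1 : SL n x (k + 1) = ev3 PsiL00 n x ((k : ℚ) + 1) * (T n (3 * (n : ℚ) - x - ((k : ℚ) + 1)) (3 * (n : ℚ) - x) *
      T n (3 * (n : ℚ) - x - ((k : ℚ) + 1)) (2 * (n : ℚ) - ((k : ℚ) + 1)))
    + ev3 PsiL01 n x ((k : ℚ) + 1) * (T n (3 * (n : ℚ) - x - ((k : ℚ) + 1)) (3 * (n : ℚ) - x) *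
      T n (3 * (n : ℚ) - x - ((k : ℚ) + 1) + 1) (2 * (n : ℚ) - ((k : ℚ) + 1)))
    + ev3 PsiL10 n x ((k : ℚ) + 1) * (T n (3 * (n : ℚ) - x - ((k : ℚ) + 1) + 1) (3 * (n : ℚ) - x) *
      T n (3 * (n : ℚ) - x - ((k : ℚ) + 1)) (2 * (n : ℚ) - ((k : ℚ) + 1)))
    + ev3 PsiL11 n x ((k : ℚ) + 1) * (T n (3 * (n : ℚ) - x - ((k : ℚ) + 1) + 1) (3 * (n : ℚ) - x) *
      T n (3 * (n : ℚ) - x - ((k : ℚ) + 1) + 1) (2 * (n : ℚ) - ((k : ℚ) + 1))) := by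
    simp only [SL, Nat.cast_add, Nat.cast_one]
  have ed0 : ddenL n x k = ((k : ℚ) + 1) * ((n : ℚ) - k) *
      ((x + k - 2 * n) ^ 2 * (x + k - 2 * n + 1) ^ 2 * (x + k - 2 * n + 2) ^ 2) := rfl
  have ed1 : ddenL n x (k + 1) = ((k : ℚ) + 1 + 1) * ((n : ℚ) - ((k : ℚ) + 1)) *
      ((x + ((k : ℚ) + 1) - 2 * n) ^ 2 * (x + ((k : ℚ) + 1) - 2 * n + 1) ^ 2 * (x + ((k : ℚ) + 1) - 2 * n + 2) ^ 2) := by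
    simp only [ddenL, Nat.cast_add, Nat.cast_one]
  rw [e0, e1, e2, e3, mul_sub]
  rw [ed0] at hg0
  rw [ed1, eS1] at hg1
  rw [eS0] at hg0
  linear_combination U * hcs + (((k : ℚ) + 2) * ((n : ℚ) - k - 1) * (x + k - 2 * n + 3) ^ 2) * hg0
    - (((k : ℚ) + 1) * ((n : ℚ) - k) * (x + k - 2 * n) ^ 2) * hg1
    - (((n : ℚ) - k) * (x + k - 2 * n) ^ 2 *
        (ev3 PsiL00 n x ((k : ℚ) + 1) * (T n (3 * (n : ℚ) - x - ((k : ℚ) + 1)) (3 * (n : ℚ) - x) *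
          T n (3 * (n : ℚ) - x - ((k : ℚ) + 1)) (2 * (n : ℚ) - ((k : ℚ) + 1)))
        + ev3 PsiL01 n x ((k : ℚ) + 1) * (T n (3 * (n : ℚ) - x - ((k : ℚ) + 1)) (3 * (n : ℚ) - x) *
          T n (3 * (n : ℚ) - x - ((k : ℚ) + 1) + 1) (2 * (n : ℚ) - ((k : ℚ) + 1)))
        + ev3 PsiL10 n x ((k : ℚ) + 1) * (T n (3 * (n : ℚ) - x - ((k : ℚ) + 1) + 1) (3 * (n : ℚ) - x) *
          T n (3 * (n : ℚ) - x - ((k : ℚ) + 1)) (2 * (n : ℚ) - ((k : ℚ) + 1)))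
        + ev3 PsiL11 n x ((k : ℚ) + 1) * (T n (3 * (n : ℚ) - x - ((k : ℚ) + 1) + 1) (3 * (n : ℚ) - x) *
          T n (3 * (n : ℚ) - x - ((k : ℚ) + 1) + 1) (2 * (n : ℚ) - ((k : ℚ) + 1))))) * hU

end VIMInner.ModRed

end Summit.KontsevichZagierPeriods.Zeta5Search.Certificates
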